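import Literature.NumberTheory.ModularSymbols.FullLevelHomologyHeckeChain
import Literature.RepresentationTheory.FiniteGroups.GL2ModularPrincipalSeriesSymPow
import Literature.RepresentationTheory.FiniteGroups.GL2ModularPrincipalSeriesLatticeTeichmuller
import Literature.NumberTheory.Automorphic.EdixhovenWeightMinimality
import Literature.NumberTheory.Automorphic.BCDTModularity
import Literature.NumberTheory.GaloisRepresentations.FramedRepTwist
import Literature.NumberTheory.EllipticCurves.Rank1Residual.Predicates
import Mathlib.AlgebraicGeometry.EllipticCurve.LFunction
import HarnessLib

/-!
# Serre weights in the full-level homology: a mod-`p` Hecke eigen-system of an elliptic curve occurring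
# `GL₂(𝔽_p)`-equivariantly in `Hom(H₁(Y(K(p)K₀(M)), ℤ_p), Sym^g ⊗ det^c)` makes a Teichmüller twist of `ρ̄_E` modular of
# weight `g + 2` and level prime to `p` (Buzzard–Diamond–Jarvis 2010 §2; Ash–Stevens)

Topic `Literature/NumberTheory/EllipticCurves`, namespace `Literature.NumberTheory.EllipticCurves`.  ONE NAMED FACT
(`def … : Prop`, D-0014; a published theorem cited to the pages that prove it; asserted nowhere; no `sorry`, no instance,
no notation).  Companion of `FullLevelHomologyTamePrincipalSeriesType.lean` (the characteristic-zero TYPE of the same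
carrier); this is the mod-`p` WEIGHT statement.  Nothing about BSD, Manin constants or period lattices is asserted.

THE OBJECTS (all in the tree).  The full-level carrier `H1carrier k p M = H₁(Γ₀(M), k[GL₂(ℤ/p)])` = `H₁(Y(K(p)K₀(M)), k)` with
its `GL₂(𝔽_p)`-action `H1carrierRep` and Hecke operators `heckeT` (`FullLevelHomologyCarrier`, `…HeckeChain`); the twisted
symmetric power `symPowTwist f χ₁ g ≅ Sym^g(std) ⊗ (χ₁ ∘ det)` of `GL₂(𝔽_p)` on binary forms of degree `g`
(`GL2ModularPrincipalSeriesSymPow`), here with `χ₁ =` the reduction of `ω̃^c` (`ω̃` the Teichmüller character), i.e.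
`σ_{g,c} := Sym^g(𝔽_p²) ⊗ det^c`; the framed mod-`p` representation `ρ̄_E` of an elliptic curve (`WeierstrassCurve.IsTorsionGaloisRep`),
its base change `ρ̄_E ⊗_j k` (`FramedRep.baseChange`) and twists `(ρ̄_E ⊗_j k) ⊗ ω^s` by powers of the mod-`p` cyclotomic character
(`FramedRep.twist`, `modPCyclotomicCharacter`); newforms `f ∈ S_w(Γ₁(N))` (`IsNewform1`) and «`ρ̄` is the reduction of `ρ_f`»
(`IsGaloisRepOfNewform1Int f ιf {q ∣ Np} ρ̄`: `charpoly ρ̄(Frob_q) = ιf(X² − a_q X + ε(q)q^{w−1})` for `q ∤ Np`), exactly as in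
`Automorphic.edixhoven1992_serreWeight_le_weight_of_newform`.

THE FACT `fullLevelHomology_twist_isModular_of_eigenMap`.  Let `p ≥ 5`, `p ∤ M`, `E/ℚ` elliptic with `E[p]` irreducible
(`Rank1Residual.Irr E p`), `0 ≤ g ≤ p − 1` and `c` with `p − 1 ∣ g + 2c` (the CENTRE of `GL₂(𝔽_p)` acts trivially on `σ_{g,c}`).
If there is a NONZERO `GL₂(𝔽_p)`-equivariant `ℤ_p`-linear `Θ : H₁(Γ₀(M), ℤ_p[GL₂(ℤ/p)]) → σ_{g,c}` which is Hecke-eigen for `E`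
(`Θ ∘ T_q = a_q(E)·Θ` for every prime `q ≠ p`), then for every framed model `ρ̄` of `E[p]`, every algebraically closed discrete `k` of
characteristic `p` with `j : 𝔽_p → k`, there are `s` with `p − 1 ∣ 2(s + c)` (i.e. `s ≡ −c` or `s ≡ −c + (p−1)/2`), a level `N` prime
to `p`, a newform `f ∈ S_{g+2}(Γ₁(N))` and `ιf : 𝓞_f → k` with `IsGaloisRepOfNewform1Int f ιf {q ∣ Np} ((ρ̄ ⊗_j k) ⊗ ω^s)`:
**a Teichmüller twist `ω^s ρ̄_E`, `2s ≡ −2c`, is modular of weight `g + 2` and level prime to `p`.**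

WHY IT IS TRUE (printed chain).  `Y := Y(K(p)K₀(M))` is the disjoint union of `p − 1` copies of `Γ' \ ℍ`, `Γ' = Γ(p) ∩ Γ₀(M)`
torsion-free (`p ≥ 5`), so `H¹(Y_{ℚ̄}, 𝔽_p) = Hom(H₁(Γ₀(M), ℤ[G]), 𝔽_p)` (universal coefficients, étale = Betti) and `Θ` is a nonzero
Hecke eigenvector (system `a_q(E) mod p`, `q ∤ pM`) of `(H¹(Y_{U'}, 𝔽̄_p) ⊗ σ)^G`, `U' = K(p)K₀(M)`, `G = GL₂(𝔽_p)`
[BuzzardDiamondJarvis2010, §2, Def. 2.1 and Lemma 2.4 (a), pp. 7–8] (the tree's chain-level `T_q` is `⟨q̄⟩^{±1}` times the adelic one,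
`q̄ ∈ Z(G)`, and the centre acts trivially on `σ_{g,c}` — see `FullLevelHomologyTamePrincipalSeriesType`, appended docstring).  By the
Eichler–Shimura relation on `Pic⁰(X_{U'})`, Čebotarev and Brauer–Nesbitt (Mazur; Boston–Lenstra–Ribet), the `𝔪`-part
(`𝔪 = (T_q − a_q(E))`) of `(Pic⁰(X_{U'})[p] ⊗ σ)^G` is nonzero with all `G_ℚ`-constituents `ρ̄_𝔪`, `tr ρ̄_𝔪(Frob_q) = a_q(E)`, hence (irreducibility)
`ρ̄_𝔪 ≅ ρ̄_E ⊗ η` for the character `η` with `det ρ̄_𝔪 = ω η²·…`; so `ρ̄_E ⊗ η` is MODULAR OF WEIGHT `σ_{g,c}` in the sense of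
[BuzzardDiamondJarvis2010, Def. 2.1]; by [ibid., Cor. 2.10 (2), p. 13] (twisting by `ω^{c}` moves the weight by `det^{c}`) and
[ibid., Prop. 2.5, p. 9] (`K = ℚ`, `(k, w) = (g+2, g+2)`, `V_{k,w} = Sym^g`), `ω^{s} ρ̄_E ∼ ρ̄_π` for a cuspidal `π` of weight `g + 2` and
level prime to `p`, i.e. a newform of weight `g+2` on some `Γ₁(N)`, `p ∤ N` (Deligne; [Langlands1973, §3], [Carayol1986ASENS]).  The
DETERMINANT pins `s`: `det(ω^s ρ̄_E) = ω^{2s+1}` must be `ε̄·ω^{g+1}` with `ε` of conductor prime to `p`, so `ω^{2s−g} = ε̄` forces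
`2s ≡ g ≡ −2c (mod p − 1)` and `ε̄ = 1`.  The exact residue `s ≡ −c` versus `s ≡ −c + (p−1)/2` (the quadratic twist by `(·/p)`, i.e.
`E` versus its `p*`-twist) depends on the normalisation of the Hecke action on `σ`-valued maps (`T_q^{σ} = det(β̄ᵢ)^{c}·T_q^{Sym^g}`,
[AshStevens1986, §1 (1.2)–(1.4)]) and is deliberately NOT asserted here.  TODO(general form): any irreducible odd `ρ̄ : G_ℚ → GL₂(𝔽̄_p)`
in place of `ρ̄_E` (BDJ treat totally real `F`); `Γ₁(M)`-levels.

Consumer: route BSD/TeichmullerTwistDescent, crux `TwistedPeriodLatticeSaturation` (stmt-BirchSwinnertonDyer-25368), input (W‴)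
`NoEtaleWeightEigenQuotient` (`g = 2b`, `c ≡ −b`: with Kraus 1997 Prop. 1 (`Kraus1997/PTorsionInertiaPotentiallyGoodOrdinary`),
Edixhoven 1992 Thm. 4.5 (`Automorphic.edixhoven1992_serreWeight_le_weight_of_newform`) and Serre's recipe this excludes `Θ ≠ 0` on the
Kodaira types II and IV (`e ∈ {3, 6}`) for either residue of `s`; type III (`e = 4`) needs `s ≡ b`, i.e. the Hecke normalisation).

## References
* K. Buzzard, F. Diamond, F. Jarvis, *On Serre's conjecture for mod ℓ Galois representations over totally real fields*, Duke Math.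
  J. 155 (2010) — §2: Def. 2.1 (p. 7), Lemma 2.4 (p. 8), Prop. 2.5 (p. 9), Cor. 2.10–2.11 (pp. 13–14); Thm. 3.15 and the explicit
  `W(ρ)` for `K = ℚ` (pp. 21–22) (held: `paper:arxiv-0810.2106`). [BuzzardDiamondJarvis2010]
* A. Ash, G. Stevens, Duke Math. J. 53 (1986), §1 (1.1)–(1.4), Thm. 3.5. [AshStevens1986]
* B. Edixhoven, Invent. Math. 109 (1992), Thm. 4.5. [Edixhoven1992]  R. P. Langlands, Antwerp II (1973), §3. [Langlands1973]
-/

noncomputable section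

namespace Literature.NumberTheory.EllipticCurves

open scoped MatrixGroups
open Literature.NumberTheory.ModularSymbols.FullLevel
open Literature.RepresentationTheory.FiniteGroups.GL2
open Literature.NumberTheory.GaloisRepresentations Literature.NumberTheory.EllipticCurves.ModularForms
open CongruenceSubgroup

/-- **A mod-`p` eigen-system of `E` in `Hom_{GL₂(𝔽_p)}(H₁(Y(K(p)K₀(M)), ℤ_p), Sym^g ⊗ det^c)` makes a Teichmüller twist of `ρ̄_E`
modular of weight `g + 2` and level prime to `p`** (Buzzard–Diamond–Jarvis 2010, §2: Def. 2.1, Lemma 2.4 (a), Prop. 2.5, Cor. 2.10 (2),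
for `K = ℚ`; with the Eichler–Shimura relation / Boston–Lenstra–Ribet on `Pic⁰(X_{U'})[p]`).  Precisely: `5 ≤ p`, `p ∤ M`,
`E[p]` irreducible, `g + 1 ≤ p`, `p − 1 ∣ g + 2c` (centre-trivial weight `σ_{g,c} = symPowTwist(castHom, reduceChar(ω̃^c), g)`),
and a NONZERO `GL₂(𝔽_p)`-equivariant `ℤ_p`-linear `Θ` from the carrier to `σ_{g,c}` with `Θ ∘ heckeT_q = a_q(E)·Θ` (all primes
`q ≠ p`) imply: for every framed `ρ̄` of `E[p]`, every algebraically closed discrete `k` of characteristic `p` and `j : 𝔽_p → k`, there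
are `s` with `p − 1 ∣ 2(s + c)`, `N` with `p ∤ N`, a newform `f ∈ S_{g+2}(Γ₁(N))` and `ιf : 𝓞_f → k` with
`IsGaloisRepOfNewform1Int f ιf {q ∣ N p} ((ρ̄ ⊗_j k).twist (ω^s))`.  The residue of `s` mod `p − 1` (`−c` vs `−c + (p−1)/2`) is
deliberately left open (Hecke normalisation on `σ`-valued maps).
[cite: BuzzardDiamondJarvis2010, §2 Def. 2.1, Lemma 2.4 (a), Prop. 2.5, Cor. 2.10 (2) (pp. 7–14)] [cite: AshStevens1986, §1 (1.2)–(1.4), Thm. 3.5]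
[cite: Langlands1973, §3]  A named fact (D-0014); asserted nowhere. -/
def fullLevelHomology_twist_isModular_of_eigenMap : Prop :=
  ∀ (p M : ℕ) [Fact p.Prime] [NeZero M] (E : WeierstrassCurve ℚ) [E.IsElliptic] (g c : ℕ),
    5 ≤ p → Nat.Coprime p M → g + 1 ≤ p → (p - 1) ∣ g + 2 * c → Rank1Residual.Irr E p →
    (letI : Algebra ℤ_[p] (ZMod p) := (PadicInt.toZMod (p := p)).toAlgebra
     ∃ Θ : H1carrier ℤ_[p] p M →ₗ[ℤ_[p]] ↥(MvPolynomial.homogeneousSubmodule (Fin 2) (ZMod p) g),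
       Θ ≠ 0 ∧
       (∀ (h : GL (Fin 2) (ZMod p)) (z : H1carrier ℤ_[p] p M),
          Θ (H1carrierRep ℤ_[p] p M h z) =
            symPowTwist (ZMod.castHom (dvd_refl p) (ZMod p))
              (reduceChar (ZMod p) (Kato2004.teichmullerChar p ^ c)) g h (Θ z)) ∧
       (∀ (q : ℕ) [NeZero q] (hq : q.Prime) (hqp : q ≠ p) (z : H1carrier ℤ_[p] p M),
          Θ (heckeT ℤ_[p] p M hq hqp z) = ((E.LFunction q : ℤ) : ZMod p) • Θ z)) →
    ∀ (ρ : ModPGaloisRep ℚ (ZMod p) 2), E.IsTorsionGaloisRep p ρ →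
    ∀ (k : Type) [Field k] [TopologicalSpace k] [DiscreteTopology k] [CharP k p] [IsAlgClosed k]
      (j : ZMod p →+* k),
    ∃ (s N : ℕ) (_ : NeZero N) (f : CuspForm (Gamma1 N) ((g : ℤ) + 2)) (ιf : coeffCharIntegers f →+* k),
      (p - 1) ∣ 2 * (s + c) ∧ ¬ p ∣ N ∧ IsNewform1 f ∧
        IsGaloisRepOfNewform1Int f ιf {q | q ∣ N * p}
          (FramedRep.twist (FramedRep.baseChange j continuous_of_discreteTopology ρ)
            (modPCyclotomicCharacter ℚ k p j ^ s))

end Literature.NumberTheory.EllipticCurves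

/-! ### Appended (bsd-line-ttd-p1 g28): the SIGNED form — the residue of `s` is `−c (mod p − 1)`

The fact above leaves `s ≡ −c` versus `s ≡ −c + (p−1)/2` open «pending the Hecke normalisation on `σ`-valued maps».  For the
tree's FIXED definitions (`heckeT` = `[γ] ⊗ δ_x ↦ Σᵢ [γ'ᵢ] ⊗ δ_{β̄ᵢx}`, `βᵢ ∈ {(1 j; 0 q), (q 0; 0 1)}`, `γ'ᵢβ_{σ(i)} = βᵢγ`;
`H1carrierRep g` = `δ_x ↦ δ_{xg⁻¹}`; `symPowTwist f χ₁ g h = χ₁(det h) · (P ↦ P((X,Y)·h))`; Mathlib chains `d(γ ⊗ a) = γ⁻¹a − a`)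
there is nothing left to choose, and the residue is COMPUTED as follows (seat memo `KLINE-SIGN-ttdp1g28.md`, evidence on
stmt-BirchSwinnertonDyer-25368, with two numeric certificates run from these very formulas).

(1) EDGE MAP.  The chains `C_* = C_*(Γ₀(M), k[G])` are free right `k[G]`-modules and `Hom_{k[G]}(C_*, V) ≅ C^*(Γ₀(M), V_r)`
(`φ ↦ (γ ↦ φ(γ ⊗ δ_1))`, `V_r` = `V` through reduction mod `p`), so the universal-coefficient spectral sequence gives the exact
`0 → Ext¹_{k[G]}(H₀, V) → H¹(Γ₀(M), V_r) → Hom_{k[G]}(H₁(Γ₀(M), k[G]), V) → Ext²_{k[G]}(H₀, V)`, Hecke-equivariantly, with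
`H₀ = k[G/SL₂(𝔽_p)] = k[𝔽_pˣ]` EISENSTEIN (`T_q = (q+1)·[q]`); at a non-Eisenstein system (`E[p]` irreducible) the edge map is an
isomorphism and transports `Θ ↦ Θ ∘ heckeT_q` to `(T^t f)(γ) = Σᵢ σ(β̄ᵢ)⁻¹ f(γ'ᵢ)` on cocycles.
(2) DUALITY.  `H¹(Γ₀(M), V_r) = H₁(Γ₀(M), (V^*)_r)^*` (`k` a field) and `T^t` is the transpose of the SAME-SHAPE homological operator
`[γ ⊗ a] ↦ Σᵢ [γ'ᵢ ⊗ σ_{V^*}(β̄ᵢ) a]` on `H₁(Γ₀(M), (V^*)_r)`; for `V = Sym^g_row ⊗ det^c` (`g ≤ p − 1`), `V^* ≅ Sym^g_row ⊗ det^{−g−c}`.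
(3) EICHLER–SHIMURA DICTIONARY.  The row-substitution action `P ↦ P((X,Y)·m)` of the monoid `M₂ ∩ GL₂` is isomorphic, with NO
determinant factor, to the main-involution column action `P ↦ P(m^ι (X,Y)ᵀ)` of modular symbols (`m^ι = det(m) m⁻¹`; intertwiner
`P ↦ P ∘ J`, `J = (0 1; −1 0)`, since `mᵀ = J m^ι J⁻¹`), and the boundary map `H₁(Γ₀(M), Sym^g) → 𝓜_{g+2}(Γ₀(M))`,
`[γ ⊗ P] ↦ −P ⊗ {α₀, γα₀}`, carries `Σᵢ[γ'ᵢ ⊗ βᵢP]` to `Σᵢ βᵢ·(P ⊗ {α₀, γα₀})` ON CYCLES (the correction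
`−Σᵢ βᵢ(γ⁻¹P − P) ⊗ {α₀, βᵢα₀}` sums to zero over a cycle); the latter is the classical `T_q = Σ_{β ∈ Γ₀(M)\Δ_q} β` of
[Shimura1971, §8.3 (8.3.2)] / [Merel1994, §1.1 (action `P|g(X,Y) = P(dX − bY, −cX + aY)`), §2.1 Prop. 10], whose eigenvalues on the cuspidal part are the Fourier coefficients `a_q(f)`,
`f ∈ S_{g+2}(Γ₀(M))` (pairing `⟨P ⊗ {α,β}, f⟩ = ∫_α^β f(z)P(z,1)dz`, `⟨βx, f⟩ = ⟨x, f|_{g+2}β⟩` with `det(β)^{g+1}` in the slash operator).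
Hence `λ_q(Θ) = q^{−g−c} · a_q(f)` — and `q^{−g−c} = q^{c}` when `p − 1 ∣ g + 2c` — i.e. `a_q(f) = q^{g+c} a_q(E)`,
`ρ̄_f ≅ ω^{g+c} ⊗ ρ̄_E` (arithmetic Frobenius, `IsArithFrobAt`, as in `HasFrobCharpolyAt`): **`s ≡ g + c ≡ −c (mod p − 1)`**.
(4) CERTIFICATES (pure Python, from the formulas above, no library): (a) `p = 11`, `M = 1`, `V = Sym^{10} ⊗ det^c` (projective, so
`Hom_G(H₁(SL₂ℤ, 𝔽₁₁[G]), V) = V/(V^S + V^{ST})`, 3-dimensional): for every `c ∈ {0,…,9}` and `q ∈ {2,3,5,7}` the matrix of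
`Θ ↦ Θ ∘ heckeT_q` is triangular with diagonal `(q^{−c}τ(q), q^{−c}τ(q), q^{−c}σ₁₁(q)) mod 11` (40/40; the residue `−c + 5` fails for
`c ∉ {0, 5}`); (b) `p = 10007`, `H₁(SL₂ℤ, Sym^g_row ⊗ det^c)`, `g ∈ {10,14,16,20}`, `c ∈ {0,1,3}`, `q ∈ {2,3}`: the same-shape operator has
eigenvalues `q^{c}a_q(f)` (multiplicity 2, `f = Δ, ΔE₄, ΔE₆, ΔE₁₀`) and `q^{c}σ_{g+1}(q)` (24/24; no other power of `q`).
So the published theorem (Ash–Stevens 1986 Thm. 3.5 (a) with §1 (1.2)–(1.4); Buzzard–Diamond–Jarvis 2010 Prop. 2.5, Cor. 2.10 (2);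
Deligne–Serre lifting) READ IN THE TREE'S CONVENTIONS is the signed statement below; the sign-free fact is its corollary
(`p − 1 ∣ s + c ⟹ p − 1 ∣ 2(s + c)`; proved Summits-side, `TeichmullerTwistDescentKOfNamedInputs`).  Consumer: (W‴) on Kodaira type III and K from five named inputs
(`Summits/…/TeichmullerTwistDescentWeightExclusionOfSignedWeight`, hypothesis `hWt1` verbatim). -/

namespace Literature.NumberTheory.EllipticCurves

open scoped MatrixGroups
open Literature.NumberTheory.ModularSymbols.FullLevel
open Literature.RepresentationTheory.FiniteGroups.GL2
open Literature.NumberTheory.GaloisRepresentations Literature.NumberTheory.EllipticCurves.ModularForms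
open CongruenceSubgroup

/-- **Signed form: a mod-`p` eigen-system of `E` in `Hom_{GL₂(𝔽_p)}(H₁(Y(K(p)K₀(M)), ℤ_p), Sym^g ⊗ det^c)` makes `ω^{−c} ρ̄_E`
modular of weight `g + 2` and level prime to `p`.**  Hypotheses exactly as in `fullLevelHomology_twist_isModular_of_eigenMap`
(`5 ≤ p`, `p ∤ M`, `E[p]` irreducible, `g + 1 ≤ p`, `p − 1 ∣ g + 2c`, a NONZERO `GL₂(𝔽_p)`-equivariant `ℤ_p`-linear `Θ` from the
carrier `H1carrier ℤ_p p M` to `symPowTwist(castHom, reduceChar(ω̃^c), g)` with `Θ ∘ heckeT_q = a_q(E)·Θ` for all primes `q ≠ p`);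
conclusion: for every framed `ρ̄` of `E[p]`, every algebraically closed discrete `k` of characteristic `p` and `j : 𝔽_p → k` there are
`s` with **`p − 1 ∣ s + c`**, `N` with `p ∤ N`, a newform `f ∈ S_{g+2}(Γ₁(N))` and `ιf : 𝓞_f → k` with
`IsGaloisRepOfNewform1Int f ιf {q ∣ Np} ((ρ̄ ⊗_j k).twist (ω^s))`.  The residue `s ≡ −c ≡ g + c (mod p − 1)` is the published
dictionary — eigen-systems in `H¹(Γ₀(M), Sym^g ⊗ det^c)` for the Hecke action through matrices `βᵢ` of determinant `q` acting on
the coefficients are `{q^{c}·a_q(f)}` up to the duality `V ↔ V^*` [AshStevens1986, §1 (1.2)–(1.4) and Thm. 3.5 (a)], Eichler–Shimura /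
modular symbols with the main-involution action [Shimura1971, §8.3 (8.3.2)], [Merel1994, §1.1, §2.1 Prop. 10] — evaluated on the tree's definitions
as recorded in the appended module docstring (edge map, duality `V^* ≅ Sym^g ⊗ det^{−g−c}`, `λ_q = q^{−g−c}a_q(f) = q^{c}a_q(f)`), with
two numeric certificates.  TODO(general form): any irreducible odd `ρ̄` in place of `ρ̄_E`; `Γ₁(M)`-levels.
[cite: BuzzardDiamondJarvis2010, §2 Def. 2.1, Lemma 2.4 (a), Prop. 2.5, Cor. 2.10 (2) (pp. 7–14)]
[cite: AshStevens1986, §1 (1.2)–(1.4), Thm. 3.5 (a)] [cite: Shimura1971, §8.3 (8.3.2)] [cite: Merel1994, §1.1, §2.1 Prop. 10]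
[cite: DeligneSerre1974, Lemme 6.11]
A named fact (D-0014); asserted nowhere. -/
def fullLevelHomology_twist_isModular_of_eigenMap_signed : Prop :=
  ∀ (p M : ℕ) [Fact p.Prime] [NeZero M] (E : WeierstrassCurve ℚ) [E.IsElliptic] (g c : ℕ),
    5 ≤ p → Nat.Coprime p M → g + 1 ≤ p → (p - 1) ∣ g + 2 * c → Rank1Residual.Irr E p →
    (letI : Algebra ℤ_[p] (ZMod p) := (PadicInt.toZMod (p := p)).toAlgebra
     ∃ Θ : H1carrier ℤ_[p] p M →ₗ[ℤ_[p]] ↥(MvPolynomial.homogeneousSubmodule (Fin 2) (ZMod p) g),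
       Θ ≠ 0 ∧
       (∀ (h : GL (Fin 2) (ZMod p)) (z : H1carrier ℤ_[p] p M),
          Θ (H1carrierRep ℤ_[p] p M h z) =
            symPowTwist (ZMod.castHom (dvd_refl p) (ZMod p))
              (reduceChar (ZMod p) (Kato2004.teichmullerChar p ^ c)) g h (Θ z)) ∧
       (∀ (q : ℕ) [NeZero q] (hq : q.Prime) (hqp : q ≠ p) (z : H1carrier ℤ_[p] p M),
          Θ (heckeT ℤ_[p] p M hq hqp z) = ((E.LFunction q : ℤ) : ZMod p) • Θ z)) →
    ∀ (ρ : ModPGaloisRep ℚ (ZMod p) 2), E.IsTorsionGaloisRep p ρ →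
    ∀ (k : Type) [Field k] [TopologicalSpace k] [DiscreteTopology k] [CharP k p] [IsAlgClosed k]
      (j : ZMod p →+* k),
    ∃ (s N : ℕ) (_ : NeZero N) (f : CuspForm (Gamma1 N) ((g : ℤ) + 2)) (ιf : coeffCharIntegers f →+* k),
      (p - 1) ∣ s + c ∧ ¬ p ∣ N ∧ IsNewform1 f ∧
        IsGaloisRepOfNewform1Int f ιf {q | q ∣ N * p}
          (FramedRep.twist (FramedRep.baseChange j continuous_of_discreteTopology ρ)
            (modPCyclotomicCharacter ℚ k p j ^ s))

end Literature.NumberTheory.EllipticCurves
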